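/-
Copyright (c) 2026 the pub-hodgecm-mathlib formalisation cell (harness21).  Prover seat hodgecm-mathlib-K2E3-p21 (g3), HCML Track B «K2-LIT» (build stream 29),
h413 = `stmt-HodgeConjecture-24833`, line `K2_E3_EllipticInputs`, unit U12 «Characters», socket #11 road (11-SC), letter (SC-an): HARISH-CHANDRA'S THEOREM 20
«cusp-form cancellation», brick (T20-c) «THE IWAHORI-FACTORISED LEVEL `K₀` AND ITS `y`-TWISTS» (line lead K2E3-p20 (g3) `CENSUS-Thm20` §4; dealer K2E3-plan (g2)
(D17) `K2/STATUS.md` 2026-09-04T01:34:25Z, open hand).  2026-09-04.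
-/
import Literature.NumberTheory.Automorphic.UnitaryGroupRankOneIwahoriDatum     -- ★ `coe_comap_congruenceGL_eq_mul` (`K_γ = (K_γ ⊓ N̄)(K_γ ⊓ T)(K_γ ⊓ N)` in `U(σ,Φ₃)`), `inv_mul_mul_mem_comap_congruenceGL_of_mem_glInt`; brings ★ `congruenceGL`, `ValBound`, `borelTriple`, `weylLongU`
import Literature.NumberTheory.Automorphic.ValuedFieldValuativeRelBridge        -- ★ `v_le_one_iff_valuation_le_one`, `mem_glInt_iff_forall_v_le_one` (the `Valued` ∕ `ValuativeRel` dictionary of ★ p856390's height balls)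
import HarnessLib

/-!
# h413 ∕ Track B «K2-LIT», line `K2_E3_EllipticInputs`, unit U12, road (11-SC), letter (SC-an) — Theorem-20 brick (T20-c): THE IWAHORI-FACTORISED LEVEL
# `K₀ = K_γ ∩ U` OF `U(σ, Φ₃)(K)` IN BOTH ORDERS, AND THE `y`-TWISTED LEVELS `K_{γ|ϖ|^{2s}} ⊆ K₀ ∩ y K₀ y⁻¹` FOR `y` IN THE HEIGHT BALL `Ω_s`
# (Harish-Chandra 1970, Part VII §2 p. 70 and §8 pp. 80–84, Lemmas 53–57; Casselman 1995, Prop. 1.4.4)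

Cell `pub/hodgecm-mathlib`, crux H413 = `stmt-HodgeConjecture-24833`, route of record `HCCMUnconditional`; chair K2-lead (g0), dealer K2E3-plan (g2), line lead of the
(SC-an) ∕ Theorem-20 bricks K2E3-p20 (g3) (`K2/K2E3-p20/g3/CENSUS-Thm20.K2E3-p20-g3.md` §4 (T20-c)).  THEOREMS ONLY (no `def`, no `instance`, no `notation`, no named-fact
hypothesis, no `sorry`); imports = ★ Literature + HarnessLib (never `Cruxes/…/Lines`); lane `--supports stmt-HodgeConjecture-24833 --as helper`, count-neutral.

THE PRINT.  Theorem 20 [HarishChandra1970, Part VII §2 p. 70, proof §8 pp. 80–84] is stated for a compact open subgroup `K₀` of `G` admitting the IWAHORI FACTORISATION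
`K₀ ⊂ (N̄ ∩ K₁)(M ∩ K₁)(N ∩ K₁)` for every cuspidal pair `(P = MN, A) ∈ 𝒫′` (p. 80), and its proof (Lemma 55, p. 83) uses, for `y ∈ G`, that a small enough ball
`{u : |u − 1| ≤ q^{−b−2σ(y)}}` lies in `K₀(y⁻¹) := K₀ ∩ K₀^{y⁻¹}`.  At RANK ONE (the organ's `U(2,1) = U(Φ₃)(L⁺_v)` at a non-split place) `𝒫′ = {(B, A), (B̄, A)}`, so BOTH
orders `N̄·T·N` and `N·T·N̄` are needed.  MODEL CURRENCY (as (T20-d) and ★ p856390 §1): `K` a field with `ValuativeRel` (and, for §3–§4, Mathlib's compatible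
`Valued K ℤᵐ⁰`), `σ : K →+* K`, `J = Φ₃` (`hJ : J = (StdForm.antidiagonal 3).over K`), `U = ↥(unitaryGroupOfForm σ J)`, the LEVELS
`K_γ := (congruenceGL 3 γ).comap U.subtype` (★ `congruenceGL`: `g, g⁻¹` integral, `g − 1, g⁻¹ − 1` with entries `≤ γ`), `T := (borelTriple σ J hJ).M`,
`N := (borelTriple σ J hJ).N`, `N̄ := N.map (MulAut.conj (weylLongU σ hJ))` — exactly the `hfac` currency of ★ `CasselmanCriterionRankOne` ∕ ★ `UnitaryGroupRankOneIwahoriDatum`.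
The CM dress along ★ `localNonsplitEquiv` is left to the assembly (T20-f) (pattern ★ `IwahoriStructureTransport`, ★ p856390 §2).

* §1 (`GL_n(F)`, any `n`, pure `ValuativeRel` algebra) `valBound_coe_conj_sub_one_of_valBound` (`y k y⁻¹ − 1 = y (k − 1) y⁻¹` has entries `≤ α γ β`),
  **`conj_mem_congruenceGL_of_valBound`** (`ValBound α y → ValBound β y⁻¹ → k ∈ K_γ → α γ β ≤ γ' ≤ 1 → y k y⁻¹ ∈ K_{γ'}`; generalises ★ `conj_mem_congruenceGL`,
  the case `y ∈ GL_n(𝒪)`), `valBound_inv_of_forall_valuation_mul_le_one` (`|c·y_{ij}| ≤ 1 ⟹ ValBound |c|⁻¹ y`).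
* §2 (`U(σ, Φ₃)(K)`) **`coe_comap_congruenceGL_eq_mul_rev`**: `K_γ = (K_γ ⊓ N)·(K_γ ⊓ T)·(K_γ ⊓ N̄)` as sets (`γ < 1`) — the OPPOSITE order, from ★
  `coe_comap_congruenceGL_eq_mul` (`K_γ = (K_γ ⊓ N̄)(K_γ ⊓ T)(K_γ ⊓ N)`) by inversion `K_γ = K_γ⁻¹`; so `K₀ := K_γ` is Iwahori-factorised for both `(B, A)` and `(B̄, A)`
  with all three factors inside `K₀` itself (stronger than print's `⊂ (N̄ ∩ K₁)(M ∩ K₁)(N ∩ K₁)`).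
* §3 (`K` with compatible `Valued K ℤᵐ⁰` and `ValuativeRel`, `U(σ, H)` for ANY `H` and any size `N`) the `y`-TWIST in the height-ball currency of ★ p856390
  (`y ∈ Ω_s ⟺ ϖ^s y, ϖ^s y⁻¹` integral): `valBound_of_forall_v_pow_mul_le_one`, **`conj_mem_comap_congruenceGL_of_heightBall`** (`y ∈ Ω_s`, `k ∈ K_{|ϖ|^{m+2s}} ⟹
  y k y⁻¹, y⁻¹ k y ∈ K_{|ϖ|^m}`), **`comap_congruenceGL_le_inf_map_conj_of_heightBall`** (`K_{|ϖ|^{m+2s}} ≤ K_{|ϖ|^m} ⊓ y K_{|ϖ|^m} y⁻¹` — Lemma 55's ball inside `K₀(y)`).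
* §4 `K_γ ⊆ Ω_0 = U ∩ GL_N(𝒪)`: `forall_v_le_one_of_mem_comap_congruenceGL` (+ the literal `ϖ^0`-form `forall_v_pow_zero_mul_le_one_of_mem_comap_congruenceGL`).
Compact-openness of `K_γ` (n = 3, local field) is ★ `isCompact_isOpen_comap_congruenceGL`; normality in `K₁` is ★ `inv_mul_mul_mem_comap_congruenceGL_of_mem_glInt`.

HONEST LABEL.  HC_CM is proved only modulo the 7 printed citations (2 remaining named inputs: hLiu418 = `stmt-HodgeConjecture-24832`, h413 = `stmt-HodgeConjecture-24833`)
until rung 0 closes; this file is a count-neutral helper (pure group bookkeeping; nothing printed is asserted beyond HC's p. 80 ∕ p. 83 set-up).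

## References
* [HarishChandra1970] Harish-Chandra (notes by G. van Dijk), *Harmonic Analysis on Reductive p-adic Groups*, LNM 162 (1970), Part VII §2 p. 70 (Theorem 20 and the
  hypothesis `K₀ ⊂ (N̄ ∩ K₁)(M ∩ K₁)(N ∩ K₁)`), §8 pp. 80–84 (Lemmas 53–57; Lemma 55 p. 83).
* [Casselman1995] W. Casselman, *Introduction to the theory of admissible representations of `p`-adic reductive groups* (1995 notes), Prop. 1.4.3, Prop. 1.4.4
  (Iwahori factorisation of the principal congruence subgroups).
* [BernsteinZelevinsky1976] I. N. Bernstein, A. V. Zelevinsky, *Representations of the group `GL(n,F)`*, Russian Math. Surveys 31:3 (1976), §3.13–3.21.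
* [Rogawski1990] J. D. Rogawski, *Automorphic Representations of Unitary Groups in Three Variables*, Ann. of Math. Stud. 123 (1990), §1.10 p. 9 (`B = MN`, `w₀`).
-/

set_option autoImplicit false
set_option linter.dupNamespace false  -- the mandated namespace repeats the single-problem summit's segment (`HodgeConjecture.HodgeConjecture`)

noncomputable section

open scoped MatrixGroups Pointwise WithZero
open ValuativeRel Matrix
open Literature.NumberTheory.Automorphic Literature.NumberTheory.Automorphic.UnitaryGroup

namespace Summit.HodgeConjecture.HodgeConjecture.Cruxes.H413.K2E3IwahoriFactorisedLevelU3

/-! ## §1 `GL_n(F)`: conjugating a principal congruence subgroup by an element of bounded height -/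

section General

variable {F : Type*} [Field F] [ValuativeRel F] {n : ℕ}

/-- **`y k y⁻¹ − 1 = y (k − 1) y⁻¹`** has entries of valuation `≤ α γ β` when the entries of `y`, `k − 1`, `y⁻¹` are `≤ α`, `γ`, `β` (ultrametric products; the
`κ ∈ GL_n(𝒪)` case is ★ `valBound_coe_conj_sub_one`). [cite: Casselman1995, Prop. 1.4.3] [cite: HarishChandra1970, Part VII §8 Lemma 55 p. 83] -/
theorem valBound_coe_conj_sub_one_of_valBound {α β γ : ValueGroupWithZero F} {y k : GL (Fin n) F}
    (hy : ValBound α (y : Matrix (Fin n) (Fin n) F)) (hy' : ValBound β ((y⁻¹ : GL (Fin n) F) : Matrix (Fin n) (Fin n) F))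
    (hk : ValBound γ ((k : Matrix (Fin n) (Fin n) F) - 1)) :
    ValBound (α * γ * β) (((y * k * y⁻¹ : GL (Fin n) F) : Matrix (Fin n) (Fin n) F) - 1) := by
  have e : (((y * k * y⁻¹ : GL (Fin n) F) : Matrix (Fin n) (Fin n) F) - 1) =
      (y : Matrix (Fin n) (Fin n) F) * ((k : Matrix (Fin n) (Fin n) F) - 1) * ((y⁻¹ : GL (Fin n) F) : Matrix (Fin n) (Fin n) F) := by
    rw [Matrix.mul_sub, Matrix.sub_mul, Matrix.mul_one, Units.val_mul, Units.val_mul,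
      Matrix.mul_assoc (y : Matrix (Fin n) (Fin n) F) (k : Matrix (Fin n) (Fin n) F),
      ← Units.val_mul, ← Units.val_mul, ← Units.val_mul, mul_inv_cancel, Units.val_one]
  rw [e]
  exact (hy.mul hk).mul hy'

/-- **THE `y`-TWIST OF A PRINCIPAL CONGRUENCE SUBGROUP (`GL_n`)**: if the entries of `y` are `≤ α`, those of `y⁻¹` are `≤ β`, `k ∈ K_γ` and `α γ β ≤ γ' ≤ 1`, then
`y k y⁻¹ ∈ K_{γ'}` (both `y k y⁻¹ − 1 = y(k−1)y⁻¹` and `(y k y⁻¹)⁻¹ − 1 = y(k⁻¹−1)y⁻¹` have entries `≤ γ'`, and a matrix `≡ 1` within `γ' ≤ 1` is integral).  For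
`y ∈ GL_n(𝒪)` (`α = β = 1`) this is the normality ★ `conj_mem_congruenceGL`; Harish-Chandra uses it with `α = β = ‖y‖ = q^{σ(y)}`.
[cite: HarishChandra1970, Part VII §8 Lemma 55 p. 83] [cite: Casselman1995, Prop. 1.4.3, Prop. 1.4.4] -/
theorem conj_mem_congruenceGL_of_valBound {α β γ γ' : ValueGroupWithZero F} {y k : GL (Fin n) F}
    (hy : ValBound α (y : Matrix (Fin n) (Fin n) F)) (hy' : ValBound β ((y⁻¹ : GL (Fin n) F) : Matrix (Fin n) (Fin n) F))
    (hk : k ∈ congruenceGL n γ) (hle : α * γ * β ≤ γ') (hγ' : γ' ≤ 1) :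
    y * k * y⁻¹ ∈ congruenceGL n γ' := by
  have h1 : ValBound γ' (((y * k * y⁻¹ : GL (Fin n) F) : Matrix (Fin n) (Fin n) F) - 1) :=
    (valBound_coe_conj_sub_one_of_valBound hy hy' hk.2.1).mono hle
  have e : (y * k * y⁻¹)⁻¹ = y * k⁻¹ * y⁻¹ := by group
  have h2 : ValBound γ' ((((y * k * y⁻¹)⁻¹ : GL (Fin n) F) : Matrix (Fin n) (Fin n) F) - 1) := by
    rw [e]
    exact (valBound_coe_conj_sub_one_of_valBound hy hy' hk.2.2).mono hle
  exact ⟨⟨h1.of_sub_one hγ', h2.of_sub_one hγ'⟩, h1, h2⟩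

/-- **Scaled integrality as an entry bound**: if `|c · M_{ij}| ≤ 1` for all entries (`c ≠ 0`) then the entries of `M` are `≤ |c|⁻¹` — the dictionary between
Harish-Chandra's height `‖M‖ ≤ |c|⁻¹` and ★ `ValBound`. [cite: HarishChandra1970, Part VII §2 p. 69] -/
theorem valBound_inv_of_forall_valuation_mul_le_one {c : F} (hc : c ≠ 0) {M : Matrix (Fin n) (Fin n) F}
    (h : ∀ i j, valuation F (c * M i j) ≤ 1) : ValBound (valuation F c)⁻¹ M := by
  intro i j
  have hc' : valuation F c ≠ 0 := (Valuation.ne_zero_iff _).2 hc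
  have h1 : valuation F c * valuation F (M i j) ≤ 1 := by rw [← Valuation.map_mul]; exact h i j
  calc valuation F (M i j) = (valuation F c)⁻¹ * (valuation F c * valuation F (M i j)) := by rw [inv_mul_cancel_left₀ hc']
    _ ≤ (valuation F c)⁻¹ * 1 := mul_le_mul' le_rfl h1
    _ = (valuation F c)⁻¹ := mul_one _

/-- The level arithmetic `|ϖ^s|⁻¹ · |ϖ|^{m+2s} · |ϖ^s|⁻¹ = |ϖ|^m` (`ϖ ≠ 0`). [cite: HarishChandra1970, Part VII §8 Lemma 55 p. 83] -/
theorem inv_mul_pow_add_two_mul_mul_inv_eq {ϖ : F} (hϖ0 : ϖ ≠ 0) (m s : ℕ) :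
    (valuation F (ϖ ^ s))⁻¹ * valuation F ϖ ^ (m + 2 * s) * (valuation F (ϖ ^ s))⁻¹ = valuation F ϖ ^ m := by
  have has : valuation F ϖ ^ s ≠ 0 := pow_ne_zero _ ((Valuation.ne_zero_iff _).2 hϖ0)
  rw [Valuation.map_pow, two_mul, ← add_assoc, pow_add, pow_add]
  calc (valuation F ϖ ^ s)⁻¹ * (valuation F ϖ ^ m * valuation F ϖ ^ s * valuation F ϖ ^ s) * (valuation F ϖ ^ s)⁻¹
      = valuation F ϖ ^ m * ((valuation F ϖ ^ s)⁻¹ * valuation F ϖ ^ s) * (valuation F ϖ ^ s * (valuation F ϖ ^ s)⁻¹) := by ac_rfl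
    _ = valuation F ϖ ^ m := by rw [inv_mul_cancel₀ has, mul_inv_cancel₀ has, mul_one, mul_one]

end General

/-! ## §2 `U(σ, Φ₃)(K)`: the Iwahori factorisation of the level `K_γ` in the OPPOSITE order `N · T · N̄` -/

section Model

variable {K : Type*} [Field K] [ValuativeRel K] (σ : K →+* K) {J : Matrix (Fin 3) (Fin 3) K}
  (hJ : J = (StdForm.antidiagonal 3).over K)

/-- **THE IWAHORI FACTORISATION OF `K_γ ∩ U(σ, Φ₃)` IN THE ORDER `N · T · N̄`**: for `γ < 1`,
`K_γ = (K_γ ⊓ N) · (K_γ ⊓ T) · (K_γ ⊓ N̄)` as subsets of `U`, where `N̄ = w₀ N w₀`.  From the `N̄ · T · N` order ★ `coe_comap_congruenceGL_eq_mul` by inversion: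
`K_γ = K_γ⁻¹ = ((K_γ ⊓ N̄)(K_γ ⊓ T)(K_γ ⊓ N))⁻¹ = (K_γ ⊓ N)(K_γ ⊓ T)(K_γ ⊓ N̄)` (each factor is a subgroup).  Together the two orders say that `K₀ := K_γ` satisfies
Harish-Chandra's hypothesis `K₀ ⊂ (N̄′ ∩ K₁)(M ∩ K₁)(N′ ∩ K₁)` for BOTH cuspidal pairs `(B, A)`, `(B̄, A)` of the rank-one group, with factors even inside `K₀`.
[cite: HarishChandra1970, Part VII §2 p. 70; §8 p. 80] [cite: Casselman1995, Prop. 1.4.4] [cite: Rogawski1990, §1.10 p. 9] -/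
theorem coe_comap_congruenceGL_eq_mul_rev {γ : ValueGroupWithZero K} (hγ : γ < 1) :
    (((congruenceGL 3 γ).comap (unitaryGroupOfForm σ J).subtype : Subgroup ↥(unitaryGroupOfForm σ J)) : Set ↥(unitaryGroupOfForm σ J)) =
      (((congruenceGL 3 γ).comap (unitaryGroupOfForm σ J).subtype ⊓ (borelTriple σ J hJ).N : Subgroup ↥(unitaryGroupOfForm σ J)) :
            Set ↥(unitaryGroupOfForm σ J)) *
        (((congruenceGL 3 γ).comap (unitaryGroupOfForm σ J).subtype ⊓ (borelTriple σ J hJ).M : Subgroup ↥(unitaryGroupOfForm σ J)) :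
            Set ↥(unitaryGroupOfForm σ J)) *
        (((congruenceGL 3 γ).comap (unitaryGroupOfForm σ J).subtype ⊓
          ((borelTriple σ J hJ).N).map (MulAut.conj (weylLongU σ hJ)).toMonoidHom : Subgroup ↥(unitaryGroupOfForm σ J)) :
            Set ↥(unitaryGroupOfForm σ J)) := by
  rw [← inv_coe_set (H := ((congruenceGL 3 γ).comap (unitaryGroupOfForm σ J).subtype : Subgroup ↥(unitaryGroupOfForm σ J))),
    coe_comap_congruenceGL_eq_mul σ hJ hγ, _root_.mul_inv_rev, _root_.mul_inv_rev, inv_coe_set, inv_coe_set, inv_coe_set, mul_assoc]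

/-- **BOTH IWAHORI ORDERS AT ONCE** (the form Theorem 20's rank-one proof consumes: one factorisation per cuspidal pair `(B, A)`, `(B̄, A)`): for `γ < 1`, every
`k ∈ K_γ ∩ U` is `n̄ t n` AND `n′ t′ n̄′` with `n̄, n̄′ ∈ K_γ ⊓ N̄`, `t, t′ ∈ K_γ ⊓ T`, `n, n′ ∈ K_γ ⊓ N` (elementwise reading of ★ `coe_comap_congruenceGL_eq_mul` and of
`coe_comap_congruenceGL_eq_mul_rev`). [cite: HarishChandra1970, Part VII §8 p. 80] [cite: Casselman1995, Prop. 1.4.4] -/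
theorem exists_iwahori_factorisations_of_mem_comap_congruenceGL {γ : ValueGroupWithZero K} (hγ : γ < 1) {k : ↥(unitaryGroupOfForm σ J)}
    (hk : k ∈ (congruenceGL 3 γ).comap (unitaryGroupOfForm σ J).subtype) :
    (∃ nb t n : ↥(unitaryGroupOfForm σ J),
      nb ∈ (congruenceGL 3 γ).comap (unitaryGroupOfForm σ J).subtype ⊓ ((borelTriple σ J hJ).N).map (MulAut.conj (weylLongU σ hJ)).toMonoidHom ∧
      t ∈ (congruenceGL 3 γ).comap (unitaryGroupOfForm σ J).subtype ⊓ (borelTriple σ J hJ).M ∧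
      n ∈ (congruenceGL 3 γ).comap (unitaryGroupOfForm σ J).subtype ⊓ (borelTriple σ J hJ).N ∧ k = nb * t * n) ∧
    (∃ n t nb : ↥(unitaryGroupOfForm σ J),
      n ∈ (congruenceGL 3 γ).comap (unitaryGroupOfForm σ J).subtype ⊓ (borelTriple σ J hJ).N ∧
      t ∈ (congruenceGL 3 γ).comap (unitaryGroupOfForm σ J).subtype ⊓ (borelTriple σ J hJ).M ∧
      nb ∈ (congruenceGL 3 γ).comap (unitaryGroupOfForm σ J).subtype ⊓ ((borelTriple σ J hJ).N).map (MulAut.conj (weylLongU σ hJ)).toMonoidHom ∧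
      k = n * t * nb) := by
  have hk1 : (k : ↥(unitaryGroupOfForm σ J)) ∈
      ((((congruenceGL 3 γ).comap (unitaryGroupOfForm σ J).subtype : Subgroup ↥(unitaryGroupOfForm σ J)) : Set ↥(unitaryGroupOfForm σ J))) := hk
  have hk2 := hk1
  rw [coe_comap_congruenceGL_eq_mul σ hJ hγ] at hk1
  rw [coe_comap_congruenceGL_eq_mul_rev σ hJ hγ] at hk2
  obtain ⟨x, hx, n, hn, rfl⟩ := Set.mem_mul.1 hk1
  obtain ⟨nb, hnb, t, ht, rfl⟩ := Set.mem_mul.1 hx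
  obtain ⟨x', hx', nb', hnb', hk'⟩ := Set.mem_mul.1 hk2
  obtain ⟨n', hn', t', ht', rfl⟩ := Set.mem_mul.1 hx'
  exact ⟨⟨nb, t, n, hnb, ht, hn, rfl⟩, ⟨n', t', nb', hn', ht', hnb', hk'.symm⟩⟩

end Model

/-! ## §3 The `y`-twisted levels in the height-ball currency `Ω_s = {y : ϖ^s y, ϖ^s y⁻¹ integral}` of ★ p856390 -/

section Twist

variable {K : Type*} [Field K] [Valued K ℤᵐ⁰] [ValuativeRel K] [(Valued.v : Valuation K ℤᵐ⁰).Compatible]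

/-- `Valued.v (ϖ^s · M_{ij}) ≤ 1` for all entries (`ϖ ≠ 0`) ⟹ the entries of `M` are `≤ |ϖ^s|⁻¹` (★ bridge `v_le_one_iff_valuation_le_one` + §1).
[cite: HarishChandra1970, Part VII §2 p. 69] -/
theorem valBound_of_forall_v_pow_mul_le_one {n : ℕ} {ϖ : K} (hϖ0 : ϖ ≠ 0) (s : ℕ) {M : Matrix (Fin n) (Fin n) K}
    (h : ∀ i j, Valued.v (ϖ ^ s * M i j) ≤ 1) : ValBound (valuation K (ϖ ^ s))⁻¹ M :=
  valBound_inv_of_forall_valuation_mul_le_one (pow_ne_zero s hϖ0) fun i j => (v_le_one_iff_valuation_le_one _).1 (h i j)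

variable (σ : K →+* K) {N : ℕ} {H : Matrix (Fin N) (Fin N) K}

/-- **THE `y`-TWIST IN THE HEIGHT-BALL CURRENCY** (Lemma 55's «`{|u − 1| ≤ q^{−b−2σ(y)}} ⊆ K₀(y⁻¹)`»): let `ϖ` be a uniformiser (`|ϖ| = exp(−1)`), `y ∈ U(σ,H)(K)` with
`ϖ^s y` and `ϖ^s y⁻¹` integral (`y ∈ Ω_s` of ★ `exists_heightBall_compactExhaustion`), and `k ∈ K_{|ϖ|^{m+2s}} ∩ U`; then `y k y⁻¹ ∈ K_{|ϖ|^m}` AND `y⁻¹ k y ∈ K_{|ϖ|^m}`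
(§1 with `α = β = |ϖ|^{−s}`; `Ω_s` is inversion-symmetric).  Any form `H`, any size `N`. [cite: HarishChandra1970, Part VII §8 Lemma 55 p. 83]
[cite: Casselman1995, Prop. 1.4.3] -/
theorem conj_mem_comap_congruenceGL_of_heightBall {ϖ : K} (hϖ : Valued.v ϖ = WithZero.exp (-1 : ℤ)) (m s : ℕ)
    {y k : ↥(unitaryGroupOfForm σ H)}
    (hy : (∀ i j, Valued.v (ϖ ^ s * ((y : GL (Fin N) K) : Matrix (Fin N) (Fin N) K) i j) ≤ 1) ∧
      ∀ i j, Valued.v (ϖ ^ s * (((y : GL (Fin N) K)⁻¹ : GL (Fin N) K) : Matrix (Fin N) (Fin N) K) i j) ≤ 1)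
    (hk : k ∈ (congruenceGL N (valuation K ϖ ^ (m + 2 * s))).comap (unitaryGroupOfForm σ H).subtype) :
    y * k * y⁻¹ ∈ (congruenceGL N (valuation K ϖ ^ m)).comap (unitaryGroupOfForm σ H).subtype ∧
      y⁻¹ * k * y ∈ (congruenceGL N (valuation K ϖ ^ m)).comap (unitaryGroupOfForm σ H).subtype := by
  have hϖ0 : ϖ ≠ 0 := by
    intro h; rw [h, map_zero] at hϖ; exact WithZero.zero_ne_coe hϖ
  have hϖ1 : valuation K ϖ ≤ 1 := by
    rw [← v_le_one_iff_valuation_le_one, hϖ, ← WithZero.exp_zero, WithZero.exp_le_exp]; norm_num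
  have hm1 : valuation K ϖ ^ m ≤ 1 := pow_le_one' hϖ1 m
  have hle : (valuation K (ϖ ^ s))⁻¹ * valuation K ϖ ^ (m + 2 * s) * (valuation K (ϖ ^ s))⁻¹ ≤ valuation K ϖ ^ m :=
    (inv_mul_pow_add_two_mul_mul_inv_eq hϖ0 m s).le
  have hkGL : (k : GL (Fin N) K) ∈ congruenceGL N (valuation K ϖ ^ (m + 2 * s)) := hk
  have hα := valBound_of_forall_v_pow_mul_le_one hϖ0 s hy.1
  have hβ := valBound_of_forall_v_pow_mul_le_one hϖ0 s hy.2
  refine ⟨?_, ?_⟩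
  · rw [Subgroup.mem_comap, Subgroup.coe_subtype, Subgroup.coe_mul, Subgroup.coe_mul, Subgroup.coe_inv]
    exact conj_mem_congruenceGL_of_valBound hα hβ hkGL hle hm1
  · rw [Subgroup.mem_comap, Subgroup.coe_subtype, Subgroup.coe_mul, Subgroup.coe_mul, Subgroup.coe_inv]
    have hβ' : ValBound (valuation K (ϖ ^ s))⁻¹ ((((y : GL (Fin N) K)⁻¹)⁻¹ : GL (Fin N) K) : Matrix (Fin N) (Fin N) K) := by
      rw [inv_inv]; exact hα
    exact conj_mem_congruenceGL_of_valBound hβ hβ' hkGL hle hm1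

/-- **`K_{|ϖ|^{m+2s}} ≤ K_{|ϖ|^m} ⊓ y K_{|ϖ|^m} y⁻¹` FOR `y ∈ Ω_s`** — the deep level sits inside Harish-Chandra's `K₀(y) = K₀ ∩ K₀^y` for `K₀ = K_{|ϖ|^m}`, uniformly in `y`
through its height only (packaging of `conj_mem_comap_congruenceGL_of_heightBall`; `K_{|ϖ|^{m+2s}} ≤ K_{|ϖ|^m}` by `|ϖ| ≤ 1`). [cite: HarishChandra1970, Part VII §8 Lemma 55 p. 83] -/
theorem comap_congruenceGL_le_inf_map_conj_of_heightBall {ϖ : K} (hϖ : Valued.v ϖ = WithZero.exp (-1 : ℤ)) (m s : ℕ)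
    {y : ↥(unitaryGroupOfForm σ H)}
    (hy : (∀ i j, Valued.v (ϖ ^ s * ((y : GL (Fin N) K) : Matrix (Fin N) (Fin N) K) i j) ≤ 1) ∧
      ∀ i j, Valued.v (ϖ ^ s * (((y : GL (Fin N) K)⁻¹ : GL (Fin N) K) : Matrix (Fin N) (Fin N) K) i j) ≤ 1) :
    (congruenceGL N (valuation K ϖ ^ (m + 2 * s))).comap (unitaryGroupOfForm σ H).subtype ≤
      (congruenceGL N (valuation K ϖ ^ m)).comap (unitaryGroupOfForm σ H).subtype ⊓
        ((congruenceGL N (valuation K ϖ ^ m)).comap (unitaryGroupOfForm σ H).subtype).map (MulAut.conj y).toMonoidHom := by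
  have hϖ1 : valuation K ϖ ≤ 1 := by
    rw [← v_le_one_iff_valuation_le_one, hϖ, ← WithZero.exp_zero, WithZero.exp_le_exp]; norm_num
  intro k hk
  refine Subgroup.mem_inf.2 ⟨?_, ?_⟩
  · exact Subgroup.comap_mono (congruenceGL_mono (pow_le_pow_right_of_le_one' hϖ1 (Nat.le_add_right m (2 * s)))) hk
  · rw [Subgroup.mem_map_equiv, MulAut.conj_symm_apply]
    exact (conj_mem_comap_congruenceGL_of_heightBall σ hϖ m s hy hk).2

end Twist

/-! ## §4 `K_γ ⊆ Ω_0 = U ∩ GL_N(𝒪)` -/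

section LevelZero

variable {K : Type*} [Field K] [Valued K ℤᵐ⁰] [ValuativeRel K] [(Valued.v : Valuation K ℤᵐ⁰).Compatible]
  (σ : K →+* K) {N : ℕ} {H : Matrix (Fin N) (Fin N) K}

/-- **`K_γ ∩ U ⊆ U ∩ GL_N(𝒪)`** read with `Valued.v`: the entries of `k` and of `k⁻¹` have `Valued.v ≤ 1` (★ `congruenceGL_le_glInt` + ★ bridge
`mem_glInt_iff_forall_v_le_one`) — i.e. `K_γ ⊆ Ω_0 = K₁` of ★ p856390, so the `Ω_m` are `K_γ`-bi-invariant. [cite: HarishChandra1970, Part VII §2 p. 69] -/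
theorem forall_v_le_one_of_mem_comap_congruenceGL {γ : ValueGroupWithZero K} {k : ↥(unitaryGroupOfForm σ H)}
    (hk : k ∈ (congruenceGL N γ).comap (unitaryGroupOfForm σ H).subtype) :
    (∀ i j, Valued.v (((k : GL (Fin N) K) : Matrix (Fin N) (Fin N) K) i j) ≤ 1) ∧
      ∀ i j, Valued.v ((((k : GL (Fin N) K)⁻¹ : GL (Fin N) K) : Matrix (Fin N) (Fin N) K) i j) ≤ 1 :=
  (mem_glInt_iff_forall_v_le_one (k : GL (Fin N) K)).1 (congruenceGL_le_glInt γ (show (k : GL (Fin N) K) ∈ congruenceGL N γ from hk))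

/-- The same in the LITERAL membership shape of ★ `exists_heightBall_compactExhaustion` at `m = 0` (`Valued.v (ϖ^0 · _) ≤ 1`): `K_γ ∩ U ⊆ Ω_0`.
[cite: HarishChandra1970, Part VII §2 p. 69] -/
theorem forall_v_pow_zero_mul_le_one_of_mem_comap_congruenceGL (ϖ : K) {γ : ValueGroupWithZero K} {k : ↥(unitaryGroupOfForm σ H)}
    (hk : k ∈ (congruenceGL N γ).comap (unitaryGroupOfForm σ H).subtype) :
    (∀ i j, Valued.v (ϖ ^ 0 * ((k : GL (Fin N) K) : Matrix (Fin N) (Fin N) K) i j) ≤ 1) ∧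
      ∀ i j, Valued.v (ϖ ^ 0 * (((k : GL (Fin N) K)⁻¹ : GL (Fin N) K) : Matrix (Fin N) (Fin N) K) i j) ≤ 1 := by
  simp only [pow_zero, one_mul]
  exact forall_v_le_one_of_mem_comap_congruenceGL σ hk

end LevelZero

end Summit.HodgeConjecture.HodgeConjecture.Cruxes.H413.K2E3IwahoriFactorisedLevelU3

end
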